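/-
Copyright (c) 2026 the pub-hodgecm-mathlib formalisation cell (harness21).  Prover seat hodgecm-mathlib-F0P2-p11 (g4): Track B «K2-LIT», squad F0∕P2 re-dealt to L1;
(σ-A) road desk K2Liu-p25 (g3) WORD #30 «= TYPE IT» (2026-09-05T02:17Z) on the block-D desk K2Liu-p12 (g6) thread (D-cls) CENSUS (β) ∕ WORD #19 «the pin is REQUIRED:
VAL OF RECORD := `c₁·τ(σc X)`»; `c₁ = −1` named by this seat from ★ p863771 `K2LiuKindOneSingularLocalFaceBall` §2.  Over ★ p864394 `K2LiuIncoherentRankOneIndexValueOfRecord`.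
#184♮ = hLiu418 = `stmt-HodgeConjecture-24832`.  THEOREMS ONLY (no `def`, no instance, no notation, no named-fact hypothesis, no `sorry`, default heartbeats).
-/
import Summits.HodgeConjecture.HodgeConjecture.Theorems.K2LiuIncoherentRankOneIndexValueOfRecord   -- ★ p864394: the `(val, α)`-generic heads under the pin `hvalc`
import HarnessLib

/-!
# Crux `HLiu418`, #42S BLOCK D — THE PINNED INDEX VALUE `val♮ X = −τ(σc X) = −(gramR 1 1·Tr_{L∕L⁺}(σc X·δ_L))` (the constant `c₁ = −1` moved INTO the value)

Cell `hodgecm-mathlib`, hLiu418 = `stmt-HodgeConjecture-24832`, route `HCCMUnconditional`; lane `--supports stmt-HodgeConjecture-24832 --as helper`.  CLOSES NO SOCKET.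

WHY ((σ-A) desk WORD #19, block-D desk (D-cls) CENSUS (β)).  Rows D-2∕D-3∕D-4 of #42S block D share ONE global value `val X ∈ L⁺`, and row D-2's cone word is read on
the LOCAL corner scalar `σc_ball X v` of the ball currency (★ p864360 `hVdef′`: `ψ_v(σc_ball X v·x)`).  ★ p863771's ball clause carries the character
`ψ_{L⁺,v}((−ι_v(gramR 1 1·Tr(σc X·δ_L)))·x)`, i.e. `σc_ball X v = ι_v(c₁·τ(σc X))` with **`c₁ = −1`** (`τ(σ) := gramR 1 1·Tr_{L∕L⁺}(σ·δ_L)`).  So the value OF RECORD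
is PINNED to `val♮ X := −τ(σc X)`: then (hnorm) of ★ p864458 `hclass'_of_dead` holds with the trivial norm `1² − θ·0²`, ★ p864394's pin `hvalc : σc X = α♮·↑(val X)` holds at
the rescaled imaginary unit `α♮ := α·↑((−κ)⁻¹)` (`κ = gramR 1 1·Tr(α·δ_L) ≠ 0`), and the constant of ★ p864394 §4 becomes `κ♮ = gramR 1 1·Tr(α♮·δ_L) = −1`, whose
valuation is `1` EVERYWHERE — the `hκT` letter of `hD_offT_of_record ∕ hint_of_record ∕ hPval_of_record` is vacuous at the pin (no `Base_κ ⊆ Tx` enlargement needed).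
EVERYTHING is hypothesis-first on ANY `val : M₂(L) → L⁺` with the literal pin `hvalR : val ↑X = −(gramR 1 1·Tr(σc X·δ_L))` (rank one) and ANY local corner
`σcv` with `hσcv : σcv X v = −ι_v(gramR 1 1·Tr(σc X·δ_L))` — both `rfl`∕`Function.extend` at the tie (`hvalR_closedForm`).
HEADS (rank `2`): §1 `kappa_pinned_eq_neg_one`, `valued_kappa_pinned`, `hκT_pinned`, `alpha_pinned_ne_zero`, `alpha_pinned_conj`; §2 `hvalc_pinned`, `hvalR_closedForm`,
`hval_pinned`, `hcorner_pinned`, `valued_valPinned_eq` (every `v`); §3 `hnorm_pinned` ((hnorm) BYTES of ★ p864458 at `n = 2`); §4 `hD_offT_pinned`, `hint_pinned`,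
`hPval_pinned` = ★ p864394 §4 WITHOUT the `hκT` letter.
HONEST LABEL.  CM-field algebra only; the corner `σc`, the witnesses' clauses (h4) (h5) (j) and the local corner enter BY VALUE; `HC_CM` is proved only modulo the 7 printed
citations (2 remaining named inputs: hLiu418 = `stmt-HodgeConjecture-24832`, h413 = `stmt-HodgeConjecture-24833`) until rung 0 closes.

## References
* [Kudla1997] S. Kudla, *Central derivatives of Eisenstein series and height pairings*, Ann. of Math. 146 (1997): §2 (incoherent collections, the local dichotomy).
* [KudlaRallis1994] S. Kudla, S. Rallis, *A regularized Siegel–Weil formula: the first term identity*, Ann. of Math. 140 (1994): §2 (2.10)–(2.12).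
* [Shimura1997] G. Shimura, *Euler Products and Eisenstein Series*, CBMS 93 (1997): §18.1 (18.4).
* [Omeara1963] O. T. O'Meara, *Introduction to Quadratic Forms* (1963): §63B (63:10).
* [CasselsFrohlichANT1967] J. W. S. Cassels, A. Fröhlich (eds.), *Algebraic Number Theory* (1967): Ch. XV (Tate) §3.1.
-/

set_option autoImplicit false
set_option linter.dupNamespace false -- the mandated namespace repeats `HodgeConjecture.HodgeConjecture`

noncomputable section

open scoped Matrix
open NumberField IsDedekindDomain
open Literature.NumberTheory.QuadraticForms
open Literature.NumberTheory.Automorphic Literature.NumberTheory.Automorphic.UnitaryGroup Literature.NumberTheory.GaloisRepresentations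
open Literature.NumberTheory.GelbartRogawski1991 Literature.NumberTheory.GelbartRogawski1991.GRConstruction
open Literature.NumberTheory.GelbartRogawski1991.UnitaryDualPair

namespace Summit.HodgeConjecture.HodgeConjecture.Cruxes.HLiu418.K2LiuIncoherentRankOneIndexValuePinned

open K2LiuSiegelUnipotentFourierDefs K2LiuKindOneSingularCornerTraceLetter K2LiuIncoherentRankOneIndexValueOfRecord

variable (L : Type) [Field L] [NumberField L] [IsCMField L]

variable {N M : ℕ} (e : Fin N × Fin M ≃ Fin 2)
  (dV : Fin N → L) (hdV : ∀ i, IsCMField.complexConj L (dV i) = dV i)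
  (dW : Fin M → L) (hdW : ∀ i, IsCMField.complexConj L (dW i) = dW i)

/-! ## §1 The pinned constants: `κ♮ = gramR 1 1·Tr(α♮·δ_L) = −1` at `α♮ = α·↑((−κ)⁻¹)`; `α♮` is an imaginary unit -/

/-- **`κ♮ = −1`**: with `κ := gramR 1 1·Tr(α·δ_L)` (`≠ 0`, ★ `kappa_ne_zero`) and `α♮ := α·↑((−κ)⁻¹)`, `gramR 1 1·Tr(α♮·δ_L) = κ·(−κ)⁻¹ = −1` (`Tr_{L∕L⁺}` is `L⁺`-linear,
★ `trace_mul_coe_mul_imagUnit`). [cite: Shimura1997, §18.1 (18.4)] -/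
theorem kappa_pinned_eq_neg_one (hdV0 : ∀ i, dV i ≠ 0) (hdW0 : ∀ i, dW i ≠ 0) {α : L} (hα0 : α ≠ 0) (hαc : IsCMField.complexConj L α = -α) :
    gramR L e dV hdV dW hdW 1 1 * Algebra.trace (Fp L) L
        (α * (((-(gramR L e dV hdV dW hdW 1 1 * Algebra.trace (Fp L) L (α * imagUnit L)))⁻¹ : Fp L) : L) * imagUnit L) = -1 := by
  rw [trace_mul_coe_mul_imagUnit L α, ← mul_assoc, inv_neg, mul_neg, mul_inv_cancel₀ (kappa_ne_zero L e dV hdV dW hdW hdV0 hdW0 hα0 hαc)]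

/-- **`|κ♮|_v = 1` AT EVERY FINITE PLACE** (`κ♮ = −1`). [cite: CasselsFrohlichANT1967, Ch. XV (Tate) §3.1] -/
theorem valued_kappa_pinned (hdV0 : ∀ i, dV i ≠ 0) (hdW0 : ∀ i, dW i ≠ 0) {α : L} (hα0 : α ≠ 0) (hαc : IsCMField.complexConj L α = -α)
    (v : HeightOneSpectrum (𝓞 (Fp L))) :
    Valued.v (algebraMap (Fp L) (v.adicCompletion (Fp L)) (gramR L e dV hdV dW hdW 1 1 * Algebra.trace (Fp L) L
        (α * (((-(gramR L e dV hdV dW hdW 1 1 * Algebra.trace (Fp L) L (α * imagUnit L)))⁻¹ : Fp L) : L) * imagUnit L))) = 1 := by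
  rw [kappa_pinned_eq_neg_one L e dV hdV dW hdW hdV0 hdW0 hα0 hαc, map_neg, map_one, Valuation.map_neg, Valuation.map_one]

/-- **★ p864394 §4's `hκT` LETTER IS VACUOUS AT THE PIN**: for ANY bad-set function `T`, `v ∉ T X h → |κ♮|_v = 1` (indeed at every `v`).
[cite: CasselsFrohlichANT1967, Ch. XV (Tate) §3.1] -/
theorem hκT_pinned (hdV0 : ∀ i, dV i ≠ 0) (hdW0 : ∀ i, dW i ≠ 0) {α : L} (hα0 : α ≠ 0) (hαc : IsCMField.complexConj L α = -α) {I H : Type*}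
    (T : I → H → Finset (HeightOneSpectrum (𝓞 (Fp L)))) :
    ∀ (X : I) (h : H) (v : HeightOneSpectrum (𝓞 (Fp L))), v ∉ T X h →
      Valued.v (algebraMap (Fp L) (v.adicCompletion (Fp L)) (gramR L e dV hdV dW hdW 1 1 * Algebra.trace (Fp L) L
        (α * (((-(gramR L e dV hdV dW hdW 1 1 * Algebra.trace (Fp L) L (α * imagUnit L)))⁻¹ : Fp L) : L) * imagUnit L))) = 1 :=
  fun _ _ v _ => valued_kappa_pinned L e dV hdV dW hdW hdV0 hdW0 hα0 hαc v

/-- **`α♮ ≠ 0`**. [cite: Shimura1997, §18.1 (18.4)] -/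
theorem alpha_pinned_ne_zero (hdV0 : ∀ i, dV i ≠ 0) (hdW0 : ∀ i, dW i ≠ 0) {α : L} (hα0 : α ≠ 0) (hαc : IsCMField.complexConj L α = -α) :
    α * (((-(gramR L e dV hdV dW hdW 1 1 * Algebra.trace (Fp L) L (α * imagUnit L)))⁻¹ : Fp L) : L) ≠ 0 := by
  refine mul_ne_zero hα0 fun h => ?_
  have h' : ((-(gramR L e dV hdV dW hdW 1 1 * Algebra.trace (Fp L) L (α * imagUnit L)))⁻¹ : Fp L) = 0 := by exact_mod_cast h
  exact inv_ne_zero (neg_ne_zero.2 (kappa_ne_zero L e dV hdV dW hdW hdV0 hdW0 hα0 hαc)) h'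

/-- **`α♮` IS IMAGINARY**: `c(α·↑r) = −(α·↑r)` for `r ∈ L⁺` and imaginary `α`. [cite: Shimura1997, §18.1 (18.4)] -/
theorem alpha_pinned_conj {α : L} (hαc : IsCMField.complexConj L α = -α) (r : Fp L) :
    IsCMField.complexConj L (α * (r : L)) = -(α * (r : L)) := by
  rw [map_mul, hαc, (IsCMField.complexConj_eq_self_iff L (r : L)).2 r.2, neg_mul]

/-! ## §2 The pin letters at `val♮`: ★ p864394's `hvalc` at `(val♮, α♮)`, the closed form, `hval`, `hcorner`, valuations at EVERY place -/

/-- **★ p864394's PIN `hvalc` AT THE PINNED VALUE**: if `val ↑X = −(gramR 1 1·Tr(σc X·δ_L))` on rank one (`hvalR`) and the corner is imaginary there (`hσ`), then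
`σc X = α♮·↑(val X)` with `α♮ = α·↑((−κ)⁻¹)` — `σc X = α·↑(Tr(α·δ_L)⁻¹·Tr(σc X·δ_L))` (★ `mul_coe_trace_inv_mul_trace`) and `(−κ)⁻¹·(−(gramR 1 1·t)) = Tr(α·δ_L)⁻¹·t`.
[cite: Shimura1997, §18.1 (18.4)] [cite: Kudla1997, §2] -/
theorem hvalc_pinned (hdV0 : ∀ i, dV i ≠ 0) (hdW0 : ∀ i, dW i ≠ 0)
    (val : Matrix (Fin 2) (Fin 2) L → ↥(maximalRealSubfield L))
    (σc : skewMatrices ((IsCMField.complexConj L : L ≃ₐ[Fp L] L) : L →+* L) ((gramR L e dV hdV dW hdW).map (algebraMap (Fp L) L)) → L)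
    {α : L} (hα0 : α ≠ 0) (hαc : IsCMField.complexConj L α = -α)
    (hσ : ∀ X : skewMatrices ((IsCMField.complexConj L : L ≃ₐ[Fp L] L) : L →+* L) ((gramR L e dV hdV dW hdW).map (algebraMap (Fp L) L)),
      (X : Matrix (Fin 2) (Fin 2) L) ≠ 0 → (X : Matrix (Fin 2) (Fin 2) L).det = 0 → IsCMField.complexConj L (σc X) = -σc X)
    (hvalR : ∀ X : skewMatrices ((IsCMField.complexConj L : L ≃ₐ[Fp L] L) : L →+* L) ((gramR L e dV hdV dW hdW).map (algebraMap (Fp L) L)),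
      (X : Matrix (Fin 2) (Fin 2) L) ≠ 0 → (X : Matrix (Fin 2) (Fin 2) L).det = 0 →
        val X = -(gramR L e dV hdV dW hdW 1 1 * Algebra.trace (Fp L) L (σc X * imagUnit L))) :
    ∀ X : skewMatrices ((IsCMField.complexConj L : L ≃ₐ[Fp L] L) : L →+* L) ((gramR L e dV hdV dW hdW).map (algebraMap (Fp L) L)),
      (X : Matrix (Fin 2) (Fin 2) L) ≠ 0 → (X : Matrix (Fin 2) (Fin 2) L).det = 0 →
        σc X = α * (((-(gramR L e dV hdV dW hdW 1 1 * Algebra.trace (Fp L) L (α * imagUnit L)))⁻¹ : Fp L) : L) * ((val X : ↥(maximalRealSubfield L)) : L) := by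
  intro X hX0 hdet
  have hg : gramR L e dV hdV dW hdW 1 1 ≠ 0 := gramR_apply_ne_zero L e dV hdV hdV0 dW hdW hdW0 1
  have hr : ((-(gramR L e dV hdV dW hdW 1 1 * Algebra.trace (Fp L) L (α * imagUnit L)))⁻¹ : Fp L) * val X =
      (Algebra.trace (Fp L) L (α * imagUnit L))⁻¹ * Algebra.trace (Fp L) L (σc X * imagUnit L) := by
    rw [hvalR X hX0 hdet, inv_neg, neg_mul_neg, mul_inv, mul_mul_mul_comm, inv_mul_cancel₀ hg, one_mul]
  rw [mul_assoc, ← MulMemClass.coe_mul, hr]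
  exact (mul_coe_trace_inv_mul_trace L hα0 hαc (hσ X hX0 hdet)).symm

/-- **THE CLOSED FORM PAYS `hvalR`**: `val♮ := fun Y => −(gramR 1 1·Tr((Function.extend Subtype.val σc 0 Y)·δ_L))` (the corner extended by `0` off the skew matrices) satisfies the
literal pin on every skew `X`. [folklore] -/
theorem hvalR_closedForm
    (σc : skewMatrices ((IsCMField.complexConj L : L ≃ₐ[Fp L] L) : L →+* L) ((gramR L e dV hdV dW hdW).map (algebraMap (Fp L) L)) → L) :
    ∀ X : skewMatrices ((IsCMField.complexConj L : L ≃ₐ[Fp L] L) : L →+* L) ((gramR L e dV hdV dW hdW).map (algebraMap (Fp L) L)),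
      (X : Matrix (Fin 2) (Fin 2) L) ≠ 0 → (X : Matrix (Fin 2) (Fin 2) L).det = 0 →
        (fun Y : Matrix (Fin 2) (Fin 2) L => -(gramR L e dV hdV dW hdW 1 1 * Algebra.trace (Fp L) L
          (Function.extend (Subtype.val : skewMatrices ((IsCMField.complexConj L : L ≃ₐ[Fp L] L) : L →+* L)
            ((gramR L e dV hdV dW hdW).map (algebraMap (Fp L) L)) → Matrix (Fin 2) (Fin 2) L) σc 0 Y * imagUnit L))) (X : Matrix (Fin 2) (Fin 2) L) =
        -(gramR L e dV hdV dW hdW 1 1 * Algebra.trace (Fp L) L (σc X * imagUnit L)) := by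
  intro X _ _
  simp only [Subtype.val_injective.extend_apply]

/-- **`hval` AT THE PIN**: `val X ≠ 0` on rank one, from ★ p864217 (g).2.2's corner-trace letter `gramR 1 1·Tr(σc X·δ_L) ≠ 0` (`val X` is its negative).
[cite: Kudla1997, §2] -/
theorem hval_pinned
    (val : Matrix (Fin 2) (Fin 2) L → ↥(maximalRealSubfield L))
    (σc : skewMatrices ((IsCMField.complexConj L : L ≃ₐ[Fp L] L) : L →+* L) ((gramR L e dV hdV dW hdW).map (algebraMap (Fp L) L)) → L)
    (hvalR : ∀ X : skewMatrices ((IsCMField.complexConj L : L ≃ₐ[Fp L] L) : L →+* L) ((gramR L e dV hdV dW hdW).map (algebraMap (Fp L) L)),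
      (X : Matrix (Fin 2) (Fin 2) L) ≠ 0 → (X : Matrix (Fin 2) (Fin 2) L).det = 0 →
        val X = -(gramR L e dV hdV dW hdW 1 1 * Algebra.trace (Fp L) L (σc X * imagUnit L)))
    (hτ : ∀ X : skewMatrices ((IsCMField.complexConj L : L ≃ₐ[Fp L] L) : L →+* L) ((gramR L e dV hdV dW hdW).map (algebraMap (Fp L) L)),
      (X : Matrix (Fin 2) (Fin 2) L) ≠ 0 → (X : Matrix (Fin 2) (Fin 2) L).det = 0 →
        gramR L e dV hdV dW hdW 1 1 * Algebra.trace (Fp L) L (σc X * imagUnit L) ≠ 0) :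
    ∀ X : skewMatrices ((IsCMField.complexConj L : L ≃ₐ[Fp L] L) : L →+* L) ((gramR L e dV hdV dW hdW).map (algebraMap (Fp L) L)),
      (X : Matrix (Fin 2) (Fin 2) L) ≠ 0 → (X : Matrix (Fin 2) (Fin 2) L).det = 0 → val X ≠ 0 := by
  intro X hX0 hdet
  rw [hvalR X hX0 hdet]
  exact neg_ne_zero.2 (hτ X hX0 hdet)

/-- **★ p863951's `hcorner` AT THE PIN** (witness `t := 1`): `∃ t ≠ 0, σc X = α♮·↑(val X)·(c t·t)` — ★ `hcorner_of_valOfRecord` over `hvalc_pinned`.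
[cite: Kudla1997, §2] [cite: KudlaRallis1994, §2 (2.10)–(2.12)] -/
theorem hcorner_pinned (hdV0 : ∀ i, dV i ≠ 0) (hdW0 : ∀ i, dW i ≠ 0)
    (val : Matrix (Fin 2) (Fin 2) L → ↥(maximalRealSubfield L))
    (σc : skewMatrices ((IsCMField.complexConj L : L ≃ₐ[Fp L] L) : L →+* L) ((gramR L e dV hdV dW hdW).map (algebraMap (Fp L) L)) → L)
    {α : L} (hα0 : α ≠ 0) (hαc : IsCMField.complexConj L α = -α)
    (hσ : ∀ X : skewMatrices ((IsCMField.complexConj L : L ≃ₐ[Fp L] L) : L →+* L) ((gramR L e dV hdV dW hdW).map (algebraMap (Fp L) L)),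
      (X : Matrix (Fin 2) (Fin 2) L) ≠ 0 → (X : Matrix (Fin 2) (Fin 2) L).det = 0 → IsCMField.complexConj L (σc X) = -σc X)
    (hvalR : ∀ X : skewMatrices ((IsCMField.complexConj L : L ≃ₐ[Fp L] L) : L →+* L) ((gramR L e dV hdV dW hdW).map (algebraMap (Fp L) L)),
      (X : Matrix (Fin 2) (Fin 2) L) ≠ 0 → (X : Matrix (Fin 2) (Fin 2) L).det = 0 →
        val X = -(gramR L e dV hdV dW hdW 1 1 * Algebra.trace (Fp L) L (σc X * imagUnit L))) :
    ∀ X : skewMatrices ((IsCMField.complexConj L : L ≃ₐ[Fp L] L) : L →+* L) ((gramR L e dV hdV dW hdW).map (algebraMap (Fp L) L)),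
      (X : Matrix (Fin 2) (Fin 2) L) ≠ 0 → (X : Matrix (Fin 2) (Fin 2) L).det = 0 →
        ∃ t : L, t ≠ 0 ∧ σc X = α * (((-(gramR L e dV hdV dW hdW 1 1 * Algebra.trace (Fp L) L (α * imagUnit L)))⁻¹ : Fp L) : L) *
          ((val X : ↥(maximalRealSubfield L)) : L) * (IsCMField.complexConj L t * t) :=
  hcorner_of_valOfRecord L e dV hdV dW hdW val σc (hvalc_pinned L e dV hdV dW hdW hdV0 hdW0 val σc hα0 hαc hσ hvalR)

omit [IsCMField L] in
/-- **VALUATIONS OF THE PINNED VALUE = VALUATIONS OF THE CORNER TRACE AT EVERY PLACE** (no `Base_κ` exception: `val X = −τ(σc X)` and `|−x|_v = |x|_v`).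
[cite: CasselsFrohlichANT1967, Ch. XV (Tate) §3.1] -/
theorem valued_valPinned_eq {I : Type*} (val : I → ↥(maximalRealSubfield L)) (τc : I → Fp L) (X : I) (hvalR : val X = -τc X)
    (v : HeightOneSpectrum (𝓞 (Fp L))) :
    Valued.v (algebraMap ↥(maximalRealSubfield L) (v.adicCompletion ↥(maximalRealSubfield L)) (val X)) =
      Valued.v (algebraMap (Fp L) (v.adicCompletion (Fp L)) (τc X)) := by
  rw [hvalR, map_neg, Valuation.map_neg]

/-! ## §3 (hnorm) of ★ p864458 `hclass'_of_dead` at the pin: the local corner IS `ι_v(val X)` — norm witness `1² − θ·0²` -/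

/-- **(hnorm) AT THE PIN** — ★ p864458 `K2LiuIncoherentRankOneBadPlaceClassLetter.hclass'_of_dead`'s (hnorm) binder BYTES at rank `2`: for ANY local corner `σcv` with
`σcv X v = −ι_v(gramR 1 1·Tr(σc X·δ_L))` (★ p863771's ball-clause scalar, `hσcv`) and the pinned value (`hvalR`), `σcv X v = ι_v(val X)·(1² − θ·0²)`, `1² − θ·0² = 1 ≠ 0`.
[cite: Omeara1963, §63B (63:10)] [cite: Kudla1997, §2] -/
theorem hnorm_pinned
    {ι : skewMatrices ((IsCMField.complexConj L : L ≃ₐ[Fp L] L) : L →+* L) ((gramR L e dV hdV dW hdW).map (algebraMap (Fp L) L)) → Type}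
    (val : Matrix (Fin 2) (Fin 2) L → ↥(maximalRealSubfield L))
    (σc : skewMatrices ((IsCMField.complexConj L : L ≃ₐ[Fp L] L) : L →+* L) ((gramR L e dV hdV dW hdW).map (algebraMap (Fp L) L)) → L)
    (σcv : skewMatrices ((IsCMField.complexConj L : L ≃ₐ[Fp L] L) : L →+* L) ((gramR L e dV hdV dW hdW).map (algebraMap (Fp L) L)) →
      ∀ v : HeightOneSpectrum (𝓞 ↥(maximalRealSubfield L)), v.adicCompletion ↥(maximalRealSubfield L))
    (hvalR : ∀ X : skewMatrices ((IsCMField.complexConj L : L ≃ₐ[Fp L] L) : L →+* L) ((gramR L e dV hdV dW hdW).map (algebraMap (Fp L) L)),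
      (X : Matrix (Fin 2) (Fin 2) L) ≠ 0 → (X : Matrix (Fin 2) (Fin 2) L).det = 0 →
        val X = -(gramR L e dV hdV dW hdW 1 1 * Algebra.trace (Fp L) L (σc X * imagUnit L)))
    (hσcv : ∀ (X : skewMatrices ((IsCMField.complexConj L : L ≃ₐ[Fp L] L) : L →+* L) ((gramR L e dV hdV dW hdW).map (algebraMap (Fp L) L)))
      (v : HeightOneSpectrum (𝓞 ↥(maximalRealSubfield L))),
      σcv X v = -(algebraMap (Fp L) (v.adicCompletion (Fp L)) (gramR L e dV hdV dW hdW 1 1 * Algebra.trace (Fp L) L (σc X * imagUnit L))))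
    (Tf : ∀ X : skewMatrices ((IsCMField.complexConj L : L ≃ₐ[Fp L] L) : L →+* L) ((gramR L e dV hdV dW hdW).map (algebraMap (Fp L) L)),
      ι X → HA L e dV hdV dW hdW → Finset (HeightOneSpectrum (𝓞 ↥(maximalRealSubfield L)))) :
    ∀ X : skewMatrices ((IsCMField.complexConj L : L ≃ₐ[Fp L] L) : L →+* L) ((gramR L e dV hdV dW hdW).map (algebraMap (Fp L) L)),
      (X : Matrix (Fin 2) (Fin 2) L) ≠ 0 → (X : Matrix (Fin 2) (Fin 2) L).det = 0 → ∀ (j : ι X) (h : HA L e dV hdV dW hdW), ∀ v ∈ Tf X j h,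
      ∃ r s : v.adicCompletion ↥(maximalRealSubfield L),
        r ^ 2 - algebraMap ↥(maximalRealSubfield L) (v.adicCompletion ↥(maximalRealSubfield L)) (cmQuadraticGenerator L : ↥(maximalRealSubfield L)) * s ^ 2 ≠ 0 ∧
        σcv X v = algebraMap ↥(maximalRealSubfield L) (v.adicCompletion ↥(maximalRealSubfield L)) (val X) *
          (r ^ 2 - algebraMap ↥(maximalRealSubfield L) (v.adicCompletion ↥(maximalRealSubfield L)) (cmQuadraticGenerator L : ↥(maximalRealSubfield L)) * s ^ 2) := by
  intro X hX0 hdet _ _ v _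
  refine ⟨1, 0, ?_, ?_⟩
  · simp
  · rw [hσcv X v, hvalR X hX0 hdet, map_neg]
    simp

/-! ## §4 ★ p864394 §4's D-4∕D-5 letters at the pin, WITHOUT the `hκT` letter -/

/-- **D-5's relaxed `hD°` AT THE PIN** — ★ `hD_offT_of_record` with `hvalc := hvalc_pinned`, `hκT := hκT_pinned`: `v ∉ T X h → |val X|_v ≠ 1 → v ∈ D X h` from (h4) BY VALUE alone.
[cite: CasselsFrohlichANT1967, Ch. XV (Tate) §3.1] [cite: Kudla1997, §2] -/
theorem hD_offT_pinned (hdV0 : ∀ i, dV i ≠ 0) (hdW0 : ∀ i, dW i ≠ 0)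
    (val : Matrix (Fin 2) (Fin 2) L → ↥(maximalRealSubfield L))
    (σc : skewMatrices ((IsCMField.complexConj L : L ≃ₐ[Fp L] L) : L →+* L) ((gramR L e dV hdV dW hdW).map (algebraMap (Fp L) L)) → L)
    {α : L} (hα0 : α ≠ 0) (hαc : IsCMField.complexConj L α = -α)
    (hσ : ∀ X : skewMatrices ((IsCMField.complexConj L : L ≃ₐ[Fp L] L) : L →+* L) ((gramR L e dV hdV dW hdW).map (algebraMap (Fp L) L)),
      (X : Matrix (Fin 2) (Fin 2) L) ≠ 0 → (X : Matrix (Fin 2) (Fin 2) L).det = 0 → IsCMField.complexConj L (σc X) = -σc X)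
    (hvalR : ∀ X : skewMatrices ((IsCMField.complexConj L : L ≃ₐ[Fp L] L) : L →+* L) ((gramR L e dV hdV dW hdW).map (algebraMap (Fp L) L)),
      (X : Matrix (Fin 2) (Fin 2) L) ≠ 0 → (X : Matrix (Fin 2) (Fin 2) L).det = 0 →
        val X = -(gramR L e dV hdV dW hdW 1 1 * Algebra.trace (Fp L) L (σc X * imagUnit L)))
    (T D : skewMatrices ((IsCMField.complexConj L : L ≃ₐ[Fp L] L) : L →+* L) ((gramR L e dV hdV dW hdW).map (algebraMap (Fp L) L)) → HA L e dV hdV dW hdW →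
      Finset (HeightOneSpectrum (𝓞 (Fp L))))
    (hD4 : ∀ S : skewMatrices ((IsCMField.complexConj L : L ≃ₐ[Fp L] L) : L →+* L) ((gramR L e dV hdV dW hdW).map (algebraMap (Fp L) L)),
      (S : Matrix (Fin 2) (Fin 2) L) ≠ 0 → (S : Matrix (Fin 2) (Fin 2) L).det = 0 → ∀ (h : HA L e dV hdV dW hdW) (v : HeightOneSpectrum (𝓞 (Fp L))),
        v ∈ D S h ↔ Valued.v (algebraMap (Fp L) (v.adicCompletion (Fp L)) (gramR L e dV hdV dW hdW 1 1 * Algebra.trace (Fp L) L (σc S * imagUnit L))) ≠ 1 ∧ v ∉ T S h) :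
    ∀ X : skewMatrices ((IsCMField.complexConj L : L ≃ₐ[Fp L] L) : L →+* L) ((gramR L e dV hdV dW hdW).map (algebraMap (Fp L) L)),
      (X : Matrix (Fin 2) (Fin 2) L) ≠ 0 → (X : Matrix (Fin 2) (Fin 2) L).det = 0 → ∀ h : HA L e dV hdV dW hdW, ∀ v, v ∉ T X h →
      Valued.v (algebraMap ↥(maximalRealSubfield L) (v.adicCompletion ↥(maximalRealSubfield L)) (val X)) ≠ 1 → v ∈ D X h :=
  hD_offT_of_record L e dV hdV dW hdW val σc (hvalc_pinned L e dV hdV dW hdW hdV0 hdW0 val σc hα0 hαc hσ hvalR) T D hD4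
    (hκT_pinned L e dV hdV dW hdW hdV0 hdW0 hα0 hαc T)

/-- **D-4's `hint` AT THE PIN** — ★ `hint_of_record` with `hvalc := hvalc_pinned`, `hκT := hκT_pinned`: `v ∈ D X h → v ∉ T X h → |val X|_v ≤ 1` from (j) BY VALUE alone.
[cite: CasselsFrohlichANT1967, Ch. XV (Tate) §3.1] -/
theorem hint_pinned (hdV0 : ∀ i, dV i ≠ 0) (hdW0 : ∀ i, dW i ≠ 0)
    (val : Matrix (Fin 2) (Fin 2) L → ↥(maximalRealSubfield L))
    (σc : skewMatrices ((IsCMField.complexConj L : L ≃ₐ[Fp L] L) : L →+* L) ((gramR L e dV hdV dW hdW).map (algebraMap (Fp L) L)) → L)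
    {α : L} (hα0 : α ≠ 0) (hαc : IsCMField.complexConj L α = -α)
    (hσ : ∀ X : skewMatrices ((IsCMField.complexConj L : L ≃ₐ[Fp L] L) : L →+* L) ((gramR L e dV hdV dW hdW).map (algebraMap (Fp L) L)),
      (X : Matrix (Fin 2) (Fin 2) L) ≠ 0 → (X : Matrix (Fin 2) (Fin 2) L).det = 0 → IsCMField.complexConj L (σc X) = -σc X)
    (hvalR : ∀ X : skewMatrices ((IsCMField.complexConj L : L ≃ₐ[Fp L] L) : L →+* L) ((gramR L e dV hdV dW hdW).map (algebraMap (Fp L) L)),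
      (X : Matrix (Fin 2) (Fin 2) L) ≠ 0 → (X : Matrix (Fin 2) (Fin 2) L).det = 0 →
        val X = -(gramR L e dV hdV dW hdW 1 1 * Algebra.trace (Fp L) L (σc X * imagUnit L)))
    (T D : skewMatrices ((IsCMField.complexConj L : L ≃ₐ[Fp L] L) : L →+* L) ((gramR L e dV hdV dW hdW).map (algebraMap (Fp L) L)) → HA L e dV hdV dW hdW →
      Finset (HeightOneSpectrum (𝓞 (Fp L))))
    (hj : ∀ (S : skewMatrices ((IsCMField.complexConj L : L ≃ₐ[Fp L] L) : L →+* L) ((gramR L e dV hdV dW hdW).map (algebraMap (Fp L) L))) (h : HA L e dV hdV dW hdW)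
      (v : HeightOneSpectrum (𝓞 (Fp L))), v ∉ T S h →
        Valued.v (algebraMap (Fp L) (v.adicCompletion (Fp L)) (gramR L e dV hdV dW hdW 1 1 * Algebra.trace (Fp L) L (σc S * imagUnit L))) ≤ 1) :
    ∀ X : skewMatrices ((IsCMField.complexConj L : L ≃ₐ[Fp L] L) : L →+* L) ((gramR L e dV hdV dW hdW).map (algebraMap (Fp L) L)),
      (X : Matrix (Fin 2) (Fin 2) L) ≠ 0 → (X : Matrix (Fin 2) (Fin 2) L).det = 0 → ∀ h : HA L e dV hdV dW hdW, ∀ v ∈ D X h, v ∉ T X h →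
      Valued.v (algebraMap ↥(maximalRealSubfield L) (v.adicCompletion ↥(maximalRealSubfield L)) (val X)) ≤ 1 :=
  hint_of_record L e dV hdV dW hdW val σc (hvalc_pinned L e dV hdV dW hdW hdV0 hdW0 val σc hα0 hαc hσ hvalR) T D hj
    (hκT_pinned L e dV hdV dW hdW hdV0 hdW0 hα0 hαc T)

/-- **D-4's `hPval` AT THE PIN, `cP := 1`** — ★ `hPval_of_record` with `hvalc := hvalc_pinned`, `hκT := hκT_pinned`: the witness's shell polynomial at the centre has
degree `ord_v(val X)`, from `hPdef` (`rfl` at the tie) and (h5) BY VALUE alone. [cite: Kudla1997, §2] [cite: KudlaRallis1994, §2 (2.10)–(2.12)] -/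
theorem hPval_pinned (hdV0 : ∀ i, dV i ≠ 0) (hdW0 : ∀ i, dW i ≠ 0)
    (val : Matrix (Fin 2) (Fin 2) L → ↥(maximalRealSubfield L))
    (σc : skewMatrices ((IsCMField.complexConj L : L ≃ₐ[Fp L] L) : L →+* L) ((gramR L e dV hdV dW hdW).map (algebraMap (Fp L) L)) → L)
    {α : L} (hα0 : α ≠ 0) (hαc : IsCMField.complexConj L α = -α)
    (hσ : ∀ X : skewMatrices ((IsCMField.complexConj L : L ≃ₐ[Fp L] L) : L →+* L) ((gramR L e dV hdV dW hdW).map (algebraMap (Fp L) L)),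
      (X : Matrix (Fin 2) (Fin 2) L) ≠ 0 → (X : Matrix (Fin 2) (Fin 2) L).det = 0 → IsCMField.complexConj L (σc X) = -σc X)
    (hvalR : ∀ X : skewMatrices ((IsCMField.complexConj L : L ≃ₐ[Fp L] L) : L →+* L) ((gramR L e dV hdV dW hdW).map (algebraMap (Fp L) L)),
      (X : Matrix (Fin 2) (Fin 2) L) ≠ 0 → (X : Matrix (Fin 2) (Fin 2) L).det = 0 →
        val X = -(gramR L e dV hdV dW hdW 1 1 * Algebra.trace (Fp L) L (σc X * imagUnit L)))
    (T D : skewMatrices ((IsCMField.complexConj L : L ≃ₐ[Fp L] L) : L →+* L) ((gramR L e dV hdV dW hdW).map (algebraMap (Fp L) L)) → HA L e dV hdV dW hdW →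
      Finset (HeightOneSpectrum (𝓞 (Fp L))))
    (mτ : skewMatrices ((IsCMField.complexConj L : L ≃ₐ[Fp L] L) : L →+* L) ((gramR L e dV hdV dW hdW).map (algebraMap (Fp L) L)) → HeightOneSpectrum (𝓞 (Fp L)) → ℕ)
    (P : skewMatrices ((IsCMField.complexConj L : L ≃ₐ[Fp L] L) : L →+* L) ((gramR L e dV hdV dW hdW).map (algebraMap (Fp L) L)) → HA L e dV hdV dW hdW →
      HeightOneSpectrum (𝓞 ↥(maximalRealSubfield L)) → ℂ → ℂ)
    (hPdef : ∀ (X : skewMatrices ((IsCMField.complexConj L : L ≃ₐ[Fp L] L) : L →+* L) ((gramR L e dV hdV dW hdW).map (algebraMap (Fp L) L))) (h : HA L e dV hdV dW hdW)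
      (v : HeightOneSpectrum (𝓞 (Fp L))) (s : ℂ),
        P X h v s = ∑ k ∈ Finset.range (mτ X v + 1), ((quadraticHeckeCharCM L).valueAtUniformizer v * (v.residueCard : ℂ) ^ (1 - 2 * s)) ^ k)
    (hm5 : ∀ (S : skewMatrices ((IsCMField.complexConj L : L ≃ₐ[Fp L] L) : L →+* L) ((gramR L e dV hdV dW hdW).map (algebraMap (Fp L) L))) (v : HeightOneSpectrum (𝓞 (Fp L))),
      mτ S v = (-WithZero.log (Valued.v (algebraMap (Fp L) (v.adicCompletion (Fp L)) (gramR L e dV hdV dW hdW 1 1 * Algebra.trace (Fp L) L (σc S * imagUnit L))))).toNat) :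
    ∀ X : skewMatrices ((IsCMField.complexConj L : L ≃ₐ[Fp L] L) : L →+* L) ((gramR L e dV hdV dW hdW).map (algebraMap (Fp L) L)),
      (X : Matrix (Fin 2) (Fin 2) L) ≠ 0 → (X : Matrix (Fin 2) (Fin 2) L).det = 0 → ∀ h : HA L e dV hdV dW hdW, ∀ v ∈ D X h, v ∉ T X h →
      P X h v (1 / 2) = 1 *
        ∑ k ∈ Finset.range ((-WithZero.log (Valued.v (algebraMap ↥(maximalRealSubfield L) (v.adicCompletion ↥(maximalRealSubfield L)) (val X)))).toNat + 1),
          ((quadraticHeckeCharCM L).valueAtUniformizer v * ((v.residueCard : ℕ) : ℂ) ^ (1 - 2 * (1 / 2 : ℂ))) ^ k :=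
  hPval_of_record L e dV hdV dW hdW val σc (hvalc_pinned L e dV hdV dW hdW hdV0 hdW0 val σc hα0 hαc hσ hvalR) T D mτ P hPdef hm5
    (hκT_pinned L e dV hdV dW hdW hdV0 hdW0 hα0 hαc T)

end Summit.HodgeConjecture.HodgeConjecture.Cruxes.HLiu418.K2LiuIncoherentRankOneIndexValuePinned

end
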